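import Summits.QuantumFields.YangMills.Theorems.CovariantDischargeTruncatedPotentialPairing
import Summits.QuantumFields.YangMills.Theorems.CovariantDischargeGreenPotentialL2
import Summits.QuantumFields.YangMills.Theorems.UnitScaleGibbsGreenPotentialMonopoleFarField
import HarnessLib

/-!
# KNIT-D of `stub_linTest` v3.1 (LINE 28 «GrossTransfer», stmt-QuantumFields-23083): THE ENERGY AND MASS ROWS OF THE TRUNCATED
# GREEN POTENTIAL ON `ℤ³` — `Σ (d₁a_R)² ≤ 328·Σω² + (shell)` and `Σ a_R² ≤ #box·3·(½(K₀+C₁)M₀)²`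

Cell `ym3-torus` (YM ladder rung R3 = continuum SU(2) Yang–Mills on the three-torus — a RUNG, NOT the Clay problem: not d = 4, not infinite
volume, not a mass gap), width seat `ym-ust-19936-w3` gen 18, on the pen of record's KNIT-PLAN (★w2-19936 g15, `KNIT-PLAN-v31`, rows R5/R6;
«KNIT-D energy/mass rows — any idle width may claim one by name»).  THEOREMS ONLY (0 `def`, default heartbeats), `ℤ³`, chart-free: the
objects are those of ✓(Z-e) `CovariantDischargeTruncatedPotentialPairing` / ✓(Z-d) `CovariantDischargeGreenPotentialL2` / ✓MONOPOLE
`UnitScaleGibbsGreenPotentialMonopoleFarField` — `ω` a 2-form on `ℤ³` supported in `box p ℓ` (the KNIT's `w̃`, the chart image of `linWeight j a`),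
`β = (G∕2)∗ω` (`hβ`), `a = δ₂β` (`ha`), `γ = d₂β` (`hγ`), a cutoff `χ` with `0 ≤ χ ≤ 1`, `χ = 1` on `box p R`, `χ = 0` off `box p S`, `|∇χ| ≤ ρ`
(✓`UnitScaleGibbsSmoothLatticeCutoff`: `ρ = 2∕R`, `S = 3R`), `a_R = χ·a` (`haR`), `d₁a_R` its curl (`hdaR`); the free kernel's first-difference decay row
`hK1` (`|G(w+e) − G(w)| ≤ C₁∕n²` off `box 0 (n−1)`, ✓`CovariantDischargeFreeGreenKernelBoxBounds.exists_fdiff_latticeGreen_box_bounds`);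
`M₀ := Σ_{μν}Σ_{y∈box p ℓ}|ω(y,μ,ν)|`, `K₀ := Σ_e |G(e_e) − G(0)|`.

* §1 (R6-sup) ★`abs_kernel_le` `|G(w+e_e) − G(w)| ≤ K₀ + C₁` EVERYWHERE (no cancellation; `w = 0` by `K₀`, `w ≠ 0` by `hK1` at `n = 1`) ⇒
  ★`abs_potential_le_sup` `|a(x,ν)| ≤ ½·(K₀ + C₁)·M₀` for every `x` and `abs_truncated_le_sup` (the same for `a_R`);
* §2 (R6) ★★`sum_sq_truncated_le`: for EVERY finite `B`, `Σ_{y∈B} Σ_ν a_R(y,ν)² ≤ #(box p S)·(3·(½(K₀+C₁)M₀)²)` (support of `a_R` ⊆ `box p S`);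
* §3 (R5-shell) the degree-1→2 commutator `E₁(y,μ,ν) := (χ(y+e_μ) − χ y)·a(y+e_μ,ν) − (χ(y+e_ν) − χ y)·a(y+e_ν,μ)` vanishes on the plateau
  `box p (R−1)` and outside `box p (S+1)` (✓(Z-b)), and OFF the plateau it is far field: for `N ≥ 1`, `N + ℓ + 2 ≤ R`, `y ∉ box p (R−1)`:
  ★`abs_commOne_le_far` `|E₁(y,μ,ν)| ≤ ρ·(3·(C₁∕N²)·M₀)` (✓MONOPOLE `abs_potential_le_far_monopole` at `y + e ∉ box p (N+ℓ)`) and its square;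
* §4 (R5) ★★★`sum_sq_curl_truncated_le_far`: for EVERY finite `B`,
  `Σ_{y∈B} Σ_μ Σ_ν (d₁a_R)² ≤ 2·(2 + 18·3²)·Σ_{y∈box p ℓ}Σ_{μν} ω² + 2·#(B ∩ shell)·9·(ρ·3·(C₁∕N²)·M₀)²`, `shell := box p (S+1) ∖ box p (R−1)`
  (✓(Z-e) `sq_curl_truncated_le` pointwise with ✓(Z-d) `poisson_of_halfGreen_conv` discharging `−Δβ = ω`, ✓(Z-d) `sum_sq_curl_potential_le`
  for the main term, §3 for the commutator), and the `B`-free corollary with `#(box p (S+1))`.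
The chart identities (`Σ_{ℤ³} w̃² = Σ_p linWeight²`, the `‖τ_α‖²` factors, `M₀ = 2(L²)^j`) and the window arithmetic are KNIT-A/E's.

HONEST: `ℤ³` finite-sum bookkeeping over landed rows; `--supports` helper; proves NO stub; `stub_linTest`, «ShallowFluxSecondMomentL», (Q),
stmt-23083/23133/23134, `HistoryTailL` (stmt-QuantumFields-19936) are NOT proved; the Yang–Mills mass gap is NOT proved.
References: Lawler 1991 Thm 1.5.5 (kernel rows, via the tree) [Lawler1991]; [Balaban1984PropagatorsII] (1.9) p. 226.
-/

noncomputable section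

set_option autoImplicit false

open scoped BigOperators
open Finset

namespace Summit.QuantumFields.YangMills.Theorems.UnitScaleGibbsTruncatedPotentialEnergyMass

open Literature.Probability.LatticeModels (latticeGreen)
open Literature.MathematicalPhysics.QuantumFieldTheory.Balaban1983to89.B4Eq19LatticeOperators
open Summit.QuantumFields.YangMills.Theorems.CovariantDischargeGreenPotentialShell (potential_eq_conv)
open Summit.QuantumFields.YangMills.Theorems.CovariantDischargeGreenPotentialL2 (poisson_of_halfGreen_conv sum_sq_curl_potential_le)
open Summit.QuantumFields.YangMills.Theorems.CovariantDischargeTruncatedPotentialPairing (sq_curl_truncated_le abs_truncated_le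
  truncated_eq_zero_off)
open Summit.QuantumFields.YangMills.Theorems.CovariantDischargeCutoffCommutator (abs_curl_comm_le curl_comm_eq_zero_of_mem_box
  curl_comm_eq_zero_of_not_mem_box)
open Summit.QuantumFields.YangMills.Theorems.UnitScaleGibbsGreenPotentialMonopoleFarField (abs_potential_le_far_monopole)

section Rows

variable {C₁ : ℝ}
  (hK1 : ∀ (e : Fin 3) (w : Zd 3) (n : ℕ), 1 ≤ n → w ∉ box (0 : Zd 3) ((n : ℤ) - 1) →
    |latticeGreen (w + unitVec e) - latticeGreen w| ≤ C₁ / (n : ℝ) ^ 2)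
  (ω β : Zd 3 → Fin 3 → Fin 3 → ℝ) (a : Zd 3 → Fin 3 → ℝ) (γ : Zd 3 → Fin 3 → Fin 3 → Fin 3 → ℝ) (p : Zd 3) (ℓ : ℕ)
  (hω0 : ∀ x, x ∉ box p (ℓ : ℤ) → ∀ μ ν, ω x μ ν = 0)
  (hβ : ∀ x μ ν, β x μ ν = ∑ y ∈ box p ℓ, latticeGreen (x - y) / 2 * ω y μ ν)
  (ha : ∀ x ν, a x ν = ∑ μ, (β (x - unitVec μ) μ ν - β x μ ν))
  (hγ : ∀ x κ μ ν, γ x κ μ ν = (β (x + unitVec κ) μ ν - β x μ ν) - (β (x + unitVec μ) κ ν - β x κ ν) + (β (x + unitVec ν) κ μ - β x κ μ))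
  (χ : Zd 3 → ℝ) (aR : Zd 3 → Fin 3 → ℝ) (daR : Zd 3 → Fin 3 → Fin 3 → ℝ) (R S : ℕ) {ρ : ℝ}
  (hχ01 : ∀ x, 0 ≤ χ x ∧ χ x ≤ 1) (hχ1 : ∀ x ∈ box p (R : ℤ), χ x = 1) (hχ0 : ∀ x, x ∉ box p (S : ℤ) → χ x = 0)
  (hχp : ∀ x μ, |χ (x + unitVec μ) - χ x| ≤ ρ)
  (haR : ∀ x ν, aR x ν = χ x * a x ν)
  (hdaR : ∀ x μ ν, daR x μ ν = (aR (x + unitVec μ) ν - aR x ν) - (aR (x + unitVec ν) μ - aR x μ))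

/-! ## §1 The sup row: the potential is bounded everywhere by `½(K₀ + C₁)·M₀` -/

include hK1 in
/-- ★ **THE FREE KERNEL'S FIRST DIFFERENCE IS BOUNDED EVERYWHERE**: `|G(w + e_e) − G(w)| ≤ K₀ + C₁`, `K₀ := Σ_e |G(e_e) − G(0)|`
(`w = 0`: one term of `K₀`; `w ≠ 0`: `w ∉ box 0 0`, row `hK1` at `n = 1`). [cite: Lawler1991, Thm 1.5.5] -/
theorem abs_kernel_le (hC₁ : 0 ≤ C₁) (e : Fin 3) (w : Zd 3) :
    |latticeGreen (w + unitVec e) - latticeGreen w| ≤ (∑ e' : Fin 3, |latticeGreen (unitVec e') - latticeGreen (0 : Zd 3)|) + C₁ := by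
  have hK₀ : 0 ≤ ∑ e' : Fin 3, |latticeGreen (unitVec e') - latticeGreen (0 : Zd 3)| := Finset.sum_nonneg fun _ _ => abs_nonneg _
  by_cases hw : w = 0
  · subst hw
    rw [zero_add]
    have h := Finset.single_le_sum (f := fun e' : Fin 3 => |latticeGreen (unitVec e') - latticeGreen (0 : Zd 3)|)
      (fun _ _ => abs_nonneg _) (Finset.mem_univ e)
    linarith
  · have hwb : w ∉ box (0 : Zd 3) (((1 : ℕ) : ℤ) - 1) := by
      intro hmem
      apply hw
      funext i
      have hi := (mem_box.mp hmem) i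
      simp only [Nat.cast_one, sub_self, Pi.zero_apply, sub_zero, abs_nonpos_iff] at hi
      exact hi
    have h := hK1 e w 1 le_rfl hwb
    simp only [Nat.cast_one, one_pow, div_one] at h
    linarith

include hK1 hβ ha in
/-- ★ **THE SUP ROW (R6-sup)**: `|a(x,ν)| ≤ ½·(K₀ + C₁)·M₀` for EVERY `x` (near field included; no cancellation in the convolution
`a = −½Σ_μ K_μ ∗ ω_{μν}`). [cite: Balaban1984PropagatorsII, (1.9) p.226] -/
theorem abs_potential_le_sup (hC₁ : 0 ≤ C₁) (x : Zd 3) (ν : Fin 3) :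
    |a x ν| ≤ 1 / 2 * ((∑ e' : Fin 3, |latticeGreen (unitVec e') - latticeGreen (0 : Zd 3)|) + C₁) *
      ∑ μ, ∑ ν', ∑ y ∈ box p (ℓ : ℤ), |ω y μ ν'| := by
  set K : ℝ := (∑ e' : Fin 3, |latticeGreen (unitVec e') - latticeGreen (0 : Zd 3)|) + C₁ with hKdef
  have hK0 : 0 ≤ K := add_nonneg (Finset.sum_nonneg fun _ _ => abs_nonneg _) hC₁
  rw [potential_eq_conv ω β a p ℓ hβ ha x ν, abs_mul, abs_neg, abs_of_pos (by norm_num : (0 : ℝ) < 1 / 2), mul_assoc]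
  refine mul_le_mul_of_nonneg_left ?_ (by norm_num)
  have hterm : ∀ μ : Fin 3, |∑ y ∈ box p (ℓ : ℤ), (latticeGreen (x - unitVec μ - y + unitVec μ) - latticeGreen (x - unitVec μ - y)) * ω y μ ν|
      ≤ K * ∑ y ∈ box p (ℓ : ℤ), |ω y μ ν| := fun μ => by
    rw [Finset.mul_sum]
    refine (Finset.abs_sum_le_sum_abs _ _).trans (Finset.sum_le_sum fun y _ => ?_)
    rw [abs_mul]
    exact mul_le_mul_of_nonneg_right (abs_kernel_le hK1 hC₁ μ (x - unitVec μ - y)) (abs_nonneg _)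
  calc |∑ μ, ∑ y ∈ box p (ℓ : ℤ), (latticeGreen (x - unitVec μ - y + unitVec μ) - latticeGreen (x - unitVec μ - y)) * ω y μ ν|
      ≤ ∑ μ, K * ∑ y ∈ box p (ℓ : ℤ), |ω y μ ν| := (Finset.abs_sum_le_sum_abs _ _).trans (Finset.sum_le_sum fun μ _ => hterm μ)
    _ = K * ∑ μ, ∑ y ∈ box p (ℓ : ℤ), |ω y μ ν| := by rw [Finset.mul_sum]
    _ ≤ K * ∑ μ, ∑ ν', ∑ y ∈ box p (ℓ : ℤ), |ω y μ ν'| := by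
        refine mul_le_mul_of_nonneg_left (Finset.sum_le_sum fun μ _ => ?_) hK0
        exact Finset.single_le_sum (f := fun ν' => ∑ y ∈ box p (ℓ : ℤ), |ω y μ ν'|)
          (fun _ _ => Finset.sum_nonneg fun _ _ => abs_nonneg _) (Finset.mem_univ ν)

include hK1 hβ ha hχ01 haR in
/-- The truncated potential obeys the same sup row: `|a_R(x,ν)| ≤ ½·(K₀ + C₁)·M₀` (`0 ≤ χ ≤ 1`). [folklore] -/
theorem abs_truncated_le_sup (hC₁ : 0 ≤ C₁) (x : Zd 3) (ν : Fin 3) :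
    |aR x ν| ≤ 1 / 2 * ((∑ e' : Fin 3, |latticeGreen (unitVec e') - latticeGreen (0 : Zd 3)|) + C₁) *
      ∑ μ, ∑ ν', ∑ y ∈ box p (ℓ : ℤ), |ω y μ ν'| :=
  (abs_truncated_le a χ aR hχ01 haR x ν).trans (abs_potential_le_sup hK1 ω β a p ℓ hβ ha hC₁ x ν)

/-! ## §2 The mass row (R6) -/

include hK1 hβ ha hχ01 hχ0 haR in
/-- ★★ **THE MASS ROW (R6)**: for EVERY finite `B ⊆ ℤ³`, `Σ_{y∈B} Σ_ν a_R(y,ν)² ≤ #(box p S) · (3 · (½(K₀+C₁)M₀)²)` — the truncated potential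
lives in `box p S` and is bounded by the sup row there. [folklore] -/
theorem sum_sq_truncated_le (hC₁ : 0 ≤ C₁) (B : Finset (Zd 3)) :
    ∑ y ∈ B, ∑ ν, aR y ν ^ 2 ≤ ((box p (S : ℤ)).card : ℝ) *
      (3 * (1 / 2 * ((∑ e' : Fin 3, |latticeGreen (unitVec e') - latticeGreen (0 : Zd 3)|) + C₁) *
        ∑ μ, ∑ ν', ∑ y ∈ box p (ℓ : ℤ), |ω y μ ν'|) ^ 2) := by
  classical
  set A : ℝ := 1 / 2 * ((∑ e' : Fin 3, |latticeGreen (unitVec e') - latticeGreen (0 : Zd 3)|) + C₁) *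
    ∑ μ, ∑ ν', ∑ y ∈ box p (ℓ : ℤ), |ω y μ ν'| with hAdef
  have h1 : ∑ y ∈ B, ∑ ν, aR y ν ^ 2 = ∑ y ∈ B ∩ box p (S : ℤ), ∑ ν, aR y ν ^ 2 := by
    refine (Finset.sum_subset Finset.inter_subset_left fun y hyB hy => ?_).symm
    rw [Finset.mem_inter, not_and] at hy
    simp only [truncated_eq_zero_off a χ aR hχ0 haR y (hy hyB), zero_pow two_ne_zero, Finset.sum_const_zero]
  have hpt : ∀ y ν, aR y ν ^ 2 ≤ A ^ 2 := fun y ν => by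
    have h := abs_truncated_le_sup hK1 ω β a p ℓ hβ ha χ aR hχ01 haR hC₁ y ν
    rw [← sq_abs]
    exact pow_le_pow_left₀ (abs_nonneg _) h 2
  rw [h1]
  calc ∑ y ∈ B ∩ box p (S : ℤ), ∑ ν, aR y ν ^ 2 ≤ ∑ y ∈ box p (S : ℤ), ∑ ν, aR y ν ^ 2 :=
        Finset.sum_le_sum_of_subset_of_nonneg Finset.inter_subset_right fun y _ _ => Finset.sum_nonneg fun ν _ => sq_nonneg _
    _ ≤ ∑ y ∈ box p (S : ℤ), ∑ _ν : Fin 3, A ^ 2 := Finset.sum_le_sum fun y _ => Finset.sum_le_sum fun ν _ => hpt y ν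
    _ = ((box p (S : ℤ)).card : ℝ) * (3 * A ^ 2) := by
        simp only [Finset.sum_const, Finset.card_univ, Fintype.card_fin, nsmul_eq_mul, Nat.cast_ofNat]

/-! ## §3 The degree-1→2 commutator `E₁`: zero on the plateau and outside, far field off the plateau -/

include hχ1 in
/-- PLATEAU: for `y ∈ box p (R − 1)` the commutator `E₁(y,μ,ν)` vanishes (`χ = 1` on `box p R`; ✓(Z-b)). [folklore] -/
theorem commOne_eq_zero_of_mem_box (y : Zd 3) (hy : y ∈ box p ((R : ℤ) - 1)) (μ ν : Fin 3) :
    (χ (y + unitVec μ) - χ y) * a (y + unitVec μ) ν - (χ (y + unitVec ν) - χ y) * a (y + unitVec ν) μ = 0 :=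
  curl_comm_eq_zero_of_mem_box hχ1 hy a μ ν

include hχ0 in
/-- OUTSIDE: for `y ∉ box p (S + 1)` the commutator `E₁(y,μ,ν)` vanishes (`χ = 0` off `box p S`; ✓(Z-b)). [folklore] -/
theorem commOne_eq_zero_of_not_mem_box (y : Zd 3) (hy : y ∉ box p ((S : ℤ) + 1)) (μ ν : Fin 3) :
    (χ (y + unitVec μ) - χ y) * a (y + unitVec μ) ν - (χ (y + unitVec ν) - χ y) * a (y + unitVec ν) μ = 0 :=
  curl_comm_eq_zero_of_not_mem_box hχ0 hy a μ ν

include hK1 hβ ha hχp in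
/-- ★ **THE COMMUTATOR OFF THE PLATEAU IS FAR FIELD (R5-shell, pointwise)**: for `N ≥ 1`, `N + ℓ + 2 ≤ R` and `y ∉ box p (R − 1)` (so
`y + e ∉ box p (N + ℓ)`): `|E₁(y,μ,ν)| ≤ ρ·(3·(C₁∕N²)·M₀)` (✓(Z-b) `abs_curl_comm_le` × ✓MONOPOLE `abs_potential_le_far_monopole` twice). [folklore] -/
theorem abs_commOne_le_far (hC₁ : 0 ≤ C₁) (N : ℕ) (hN : 1 ≤ N) (hR : (N : ℤ) + ℓ + 2 ≤ R) (y : Zd 3)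
    (hy : y ∉ box p ((R : ℤ) - 1)) (μ ν : Fin 3) :
    |(χ (y + unitVec μ) - χ y) * a (y + unitVec μ) ν - (χ (y + unitVec ν) - χ y) * a (y + unitVec ν) μ|
      ≤ ρ * (3 * (C₁ / (N : ℝ) ^ 2) * ∑ μ', ∑ ν', ∑ y' ∈ box p (ℓ : ℤ), |ω y' μ' ν'|) := by
  have hy' : y ∉ box p ((N : ℤ) + ℓ + 1) := fun h => hy (box_mono p (by linarith) h)
  have hfar : ∀ κ : Fin 3, y + unitVec κ ∉ box p ((N : ℤ) + ℓ) := fun κ => add_unitVec_not_mem_box hy' κ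
  have hμ := abs_potential_le_far_monopole hK1 ω β a p ℓ hβ ha hC₁ (y + unitVec μ) ν N hN (hfar μ)
  have hν := abs_potential_le_far_monopole hK1 ω β a p ℓ hβ ha hC₁ (y + unitVec ν) μ N hN (hfar ν)
  have hρ : 0 ≤ ρ := (abs_nonneg _).trans (hχp y μ)
  calc |(χ (y + unitVec μ) - χ y) * a (y + unitVec μ) ν - (χ (y + unitVec ν) - χ y) * a (y + unitVec ν) μ|
      ≤ ρ * (|a (y + unitVec μ) ν| + |a (y + unitVec ν) μ|) := abs_curl_comm_le hχp a y μ ν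
    _ ≤ ρ * (3 / 2 * (C₁ / (N : ℝ) ^ 2) * ∑ μ', ∑ ν', ∑ y' ∈ box p (ℓ : ℤ), |ω y' μ' ν'|
        + 3 / 2 * (C₁ / (N : ℝ) ^ 2) * ∑ μ', ∑ ν', ∑ y' ∈ box p (ℓ : ℤ), |ω y' μ' ν'|) :=
        mul_le_mul_of_nonneg_left (add_le_add hμ hν) hρ
    _ = ρ * (3 * (C₁ / (N : ℝ) ^ 2) * ∑ μ', ∑ ν', ∑ y' ∈ box p (ℓ : ℤ), |ω y' μ' ν'|) := by ring

include hK1 hβ ha hχp in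
/-- The same, squared: `E₁(y,μ,ν)² ≤ (ρ·3·(C₁∕N²)·M₀)²` off the plateau. [folklore] -/
theorem sq_commOne_le_far (hC₁ : 0 ≤ C₁) (N : ℕ) (hN : 1 ≤ N) (hR : (N : ℤ) + ℓ + 2 ≤ R) (y : Zd 3)
    (hy : y ∉ box p ((R : ℤ) - 1)) (μ ν : Fin 3) :
    ((χ (y + unitVec μ) - χ y) * a (y + unitVec μ) ν - (χ (y + unitVec ν) - χ y) * a (y + unitVec ν) μ) ^ 2
      ≤ (ρ * (3 * (C₁ / (N : ℝ) ^ 2) * ∑ μ', ∑ ν', ∑ y' ∈ box p (ℓ : ℤ), |ω y' μ' ν'|)) ^ 2 := by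
  have h := abs_commOne_le_far hK1 ω β a p ℓ hβ ha χ R hχp hC₁ N hN hR y hy μ ν
  rw [← sq_abs]
  exact pow_le_pow_left₀ (abs_nonneg _) h 2

/-! ## §4 The energy row (R5) -/

include hK1 hω0 hβ ha hγ hχ01 hχ1 hχ0 hχp haR hdaR in
/-- ★★★ **THE ENERGY ROW (R5)**: for EVERY finite `B ⊆ ℤ³`, `N ≥ 1`, `N + ℓ + 2 ≤ R`:
`Σ_{y∈B} Σ_μ Σ_ν (d₁a_R)(y,μ,ν)² ≤ 2·(2 + 18·3²)·Σ_{y∈box p ℓ} Σ_{μν} ω(y,μ,ν)² + 2·#(B ∩ (box p (S+1) ∖ box p (R−1)))·9·(ρ·3·(C₁∕N²)·M₀)²` —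
the charge-plus-bulk term is ✓(Z-d)'s `j`-uniform ℓ² row (Poisson equation discharged by ✓`poisson_of_halfGreen_conv`), the commutator term
lives on the shell and is far field there. [cite: Balaban1984PropagatorsII, (1.9) p.226] -/
theorem sum_sq_curl_truncated_le_far (hC₁ : 0 ≤ C₁) (N : ℕ) (hN : 1 ≤ N) (hR : (N : ℤ) + ℓ + 2 ≤ R) (B : Finset (Zd 3)) :
    ∑ y ∈ B, ∑ μ, ∑ ν, daR y μ ν ^ 2
      ≤ 2 * ((2 + 18 * (3 : ℝ) ^ 2) * ∑ y ∈ box p (ℓ : ℤ), ∑ μ, ∑ ν, ω y μ ν ^ 2)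
        + 2 * (((B.filter fun y => y ∈ box p ((S : ℤ) + 1) ∧ y ∉ box p ((R : ℤ) - 1)).card : ℝ) *
          (9 * (ρ * (3 * (C₁ / (N : ℝ) ^ 2) * ∑ μ', ∑ ν', ∑ y' ∈ box p (ℓ : ℤ), |ω y' μ' ν'|)) ^ 2)) := by
  classical
  set Efar : ℝ := (ρ * (3 * (C₁ / (N : ℝ) ^ 2) * ∑ μ', ∑ ν', ∑ y' ∈ box p (ℓ : ℤ), |ω y' μ' ν'|)) ^ 2 with hEfar
  -- the Poisson equation for `β = (G∕2)∗ω`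
  have hΔ : ∀ x μ ν, ω x μ ν = ∑ κ, (2 * β x μ ν - β (x + unitVec κ) μ ν - β (x - unitVec κ) μ ν) :=
    poisson_of_halfGreen_conv le_rfl ω β p (ℓ : ℤ) hω0 hβ
  -- pointwise split `(d₁a_R)² ≤ 2D² + 2E₁²`
  have hpt : ∀ y μ ν, daR y μ ν ^ 2 ≤ 2 * (ω y μ ν - ∑ κ, (γ (y - unitVec κ) κ μ ν - γ y κ μ ν)) ^ 2
      + 2 * ((χ (y + unitVec μ) - χ y) * a (y + unitVec μ) ν - (χ (y + unitVec ν) - χ y) * a (y + unitVec ν) μ) ^ 2 :=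
    fun y μ ν => sq_curl_truncated_le ω β a γ χ aR daR hΔ ha hγ hχ01 haR hdaR y μ ν
  -- the commutator term, pointwise with the shell indicator
  have hE : ∀ y μ ν, ((χ (y + unitVec μ) - χ y) * a (y + unitVec μ) ν - (χ (y + unitVec ν) - χ y) * a (y + unitVec ν) μ) ^ 2
      ≤ if y ∈ box p ((S : ℤ) + 1) ∧ y ∉ box p ((R : ℤ) - 1) then Efar else 0 := by
    intro y μ ν
    split_ifs with hsh
    · exact sq_commOne_le_far hK1 ω β a p ℓ hβ ha χ R hχp hC₁ N hN hR y hsh.2 μ ν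
    · rw [not_and_or, not_not] at hsh
      rcases hsh with hout | hin
      · rw [commOne_eq_zero_of_not_mem_box a p χ S hχ0 y hout μ ν]; simp
      · rw [commOne_eq_zero_of_mem_box a p χ R hχ1 y hin μ ν]; simp
  -- sum the split
  have hsum : ∑ y ∈ B, ∑ μ, ∑ ν, daR y μ ν ^ 2
      ≤ 2 * ∑ y ∈ B, ∑ μ, ∑ ν, (ω y μ ν - ∑ κ, (γ (y - unitVec κ) κ μ ν - γ y κ μ ν)) ^ 2
        + 2 * ∑ y ∈ B, ∑ _μ : Fin 3, ∑ _ν : Fin 3, (if y ∈ box p ((S : ℤ) + 1) ∧ y ∉ box p ((R : ℤ) - 1) then Efar else 0) := by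
    calc ∑ y ∈ B, ∑ μ, ∑ ν, daR y μ ν ^ 2
        ≤ ∑ y ∈ B, ∑ μ, ∑ ν, (2 * (ω y μ ν - ∑ κ, (γ (y - unitVec κ) κ μ ν - γ y κ μ ν)) ^ 2
            + 2 * (if y ∈ box p ((S : ℤ) + 1) ∧ y ∉ box p ((R : ℤ) - 1) then Efar else 0)) :=
          Finset.sum_le_sum fun y _ => Finset.sum_le_sum fun μ _ => Finset.sum_le_sum fun ν _ => by
            have h1 := hpt y μ ν
            have h2 := hE y μ ν
            linarith
      _ = _ := by simp only [Finset.sum_add_distrib, Finset.mul_sum]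
  refine hsum.trans (add_le_add ?_ ?_)
  · -- the `j`-uniform ℓ² row of (Z-d)
    have h := sum_sq_curl_potential_le (le_rfl : 3 ≤ 3) ω β γ p (ℓ : ℤ) hω0 hβ hγ B
    have h3 : ((3 : ℕ) : ℝ) = (3 : ℝ) := by norm_num
    rw [h3] at h
    linarith
  · -- the shell count
    refine mul_le_mul_of_nonneg_left ?_ (by norm_num)
    have hE0 : 0 ≤ Efar := by rw [hEfar]; positivity
    rw [← Finset.sum_filter_add_sum_filter_not B (fun y => y ∈ box p ((S : ℤ) + 1) ∧ y ∉ box p ((R : ℤ) - 1))]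
    have hin : ∑ y ∈ B.filter (fun y => y ∈ box p ((S : ℤ) + 1) ∧ y ∉ box p ((R : ℤ) - 1)), ∑ _μ : Fin 3, ∑ _ν : Fin 3,
        (if y ∈ box p ((S : ℤ) + 1) ∧ y ∉ box p ((R : ℤ) - 1) then Efar else 0)
        = ((B.filter fun y => y ∈ box p ((S : ℤ) + 1) ∧ y ∉ box p ((R : ℤ) - 1)).card : ℝ) * (9 * Efar) := by
      rw [Finset.sum_congr rfl fun y hy => by rw [if_pos (Finset.mem_filter.mp hy).2]]
      simp only [Finset.sum_const, Finset.card_univ, Fintype.card_fin, nsmul_eq_mul, Nat.cast_ofNat]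
      ring
    have hout : ∑ y ∈ B.filter (fun y => ¬(y ∈ box p ((S : ℤ) + 1) ∧ y ∉ box p ((R : ℤ) - 1))), ∑ _μ : Fin 3, ∑ _ν : Fin 3,
        (if y ∈ box p ((S : ℤ) + 1) ∧ y ∉ box p ((R : ℤ) - 1) then Efar else 0) = 0 := by
      refine Finset.sum_eq_zero fun y hy => ?_
      rw [if_neg (Finset.mem_filter.mp hy).2]
      simp
    rw [hin, hout, add_zero]

include hK1 hω0 hβ ha hγ hχ01 hχ1 hχ0 hχp haR hdaR in
/-- ★★ **THE ENERGY ROW, `B`-free shell count**: the same with `#(box p (S+1))` in place of `#(B ∩ shell)`. [folklore] -/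
theorem sum_sq_curl_truncated_le_far' (hC₁ : 0 ≤ C₁) (N : ℕ) (hN : 1 ≤ N) (hR : (N : ℤ) + ℓ + 2 ≤ R) (B : Finset (Zd 3)) :
    ∑ y ∈ B, ∑ μ, ∑ ν, daR y μ ν ^ 2
      ≤ 2 * ((2 + 18 * (3 : ℝ) ^ 2) * ∑ y ∈ box p (ℓ : ℤ), ∑ μ, ∑ ν, ω y μ ν ^ 2)
        + 2 * (((box p ((S : ℤ) + 1)).card : ℝ) *
          (9 * (ρ * (3 * (C₁ / (N : ℝ) ^ 2) * ∑ μ', ∑ ν', ∑ y' ∈ box p (ℓ : ℤ), |ω y' μ' ν'|)) ^ 2)) := by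
  classical
  have h := sum_sq_curl_truncated_le_far hK1 ω β a γ p ℓ hω0 hβ ha hγ χ aR daR R S hχ01 hχ1 hχ0 hχp haR hdaR hC₁ N hN hR B
  have hsub : (B.filter fun y => y ∈ box p ((S : ℤ) + 1) ∧ y ∉ box p ((R : ℤ) - 1)) ⊆ box p ((S : ℤ) + 1) :=
    fun y hy => (Finset.mem_filter.mp hy).2.1
  refine h.trans (add_le_add le_rfl (mul_le_mul_of_nonneg_left (mul_le_mul_of_nonneg_right ?_ (by positivity)) (by norm_num)))
  exact_mod_cast Finset.card_le_card hsub

end Rows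

end Summit.QuantumFields.YangMills.Theorems.UnitScaleGibbsTruncatedPotentialEnergyMass

end
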